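import Summits.KontsevichZagierPeriods.Zeta5Search.Barrier.ConeGammaCuspPeriodCertificate

/-!
# ζ(5) search — BARRIER: THE KINK OF THE CUSP SLOPE ACROSS A WALL IS THE LOCAL DEFECT OF THE PERIOD PATTERN FUNCTION

HONEST FRAMING (cell `pub-zeta5`): systematic search; no irrationality claim unless kernel-certified. MODEL objects
under Brown–Zudilin's (28)+(30) accounting ([BZ22] = arXiv:2210.03391; (28) observed, not proved); nothing here is a
statement about `ζ(5)`, any `γ` of record, the cone's supremum (C2 OPEN) or the value / sign of any kink, weight or
defect at a named direction (DATA of the cell); S-E stays CONJECTURED; records in print UNMOVED. Prover P2 g31, item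
«ONE SET FUNCTION» (INBOX 2026-08-27), file (4): the period-level form of P2 g30's `ConeGammaCuspGermKink`.

With the period pattern function `F(A) = Σ_m f m (A ∩ M m)` (file (1)):
* `period_defect_eq_sum_junction_defects` — the LOCAL DEFECT of `F` behind a prefix `S` at a pair `k, l`,
  `m_F(S;k,l) = F(S∪{k}) + F(S∪{l}) − F(S) − F(S∪{k,l})`, is the SUM over the junctions where BOTH `k` and `l` are
  members of their own local defects behind `S ∩ M m` (the other junctions contribute `0`) — pure set-function algebra:
  kinks of different junctions across one coincidence wall ADD UP (and may cancel);
* **`cuspSlope_eq_greedy_add_defect_period`** — two generic references `δ₀, δ₀'` on all 28 forms whose flip orders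
  differ by ONE adjacent transposition `k ↔ l` (common earlier set `S`): for every `δ` in the closed chamber of `δ₀'`,
  `σ(δ) = Σ_j W_j(δ₀)·φ_j(δ)/h_j(a) + m_F(S;k,l)·(φ_l(δ)/h_l − φ_k(δ)/h_k)` — ACROSS THE WALL `r_k = r_l` the cusp slope is
  the old chamber functional plus the local defect of `F` times the splitting: the wall is a kink of `σ` iff
  `m_F ≠ 0`, convex iff `m_F > 0`, concave iff `m_F < 0` (P2 g29's kink census (T4) at the level of the period).
DESK (DATA, `HOME/pub-zeta5-p2/g31/alg/periodlovasz.py` (L3)): pooled wall defects at 378 walls × random prefixes take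
both signs at every named direction (record [−22, 16], flag [−14, 8], argmax-120 [−25, 12], t* [−104, 11]); on 16 / 16 /
15 / 10 walls junction defects of both signs pool to one sign. NOT here: the defect of any named wall; `γ`, C2, S-E,
`ζ(5)`.
-/

noncomputable section

open Set MeasureTheory Finset
open scoped Topology

namespace Summit.KontsevichZagierPeriods.Zeta5Search.Barrier.ConeGamma

/-! ### The local defect of the period pattern function pools the junction defects on the wall -/

/-- **LOCAL DEFECT OF `F` = SUM OF THE JUNCTION DEFECTS ON THE WALL.** For `F(A) = Σ_{m<N} f m (A ∩ M m)`, any `S` and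
any two forms `k, l`: `F(S∪{k}) + F(S∪{l}) − F(S) − F(S∪{k,l}) = Σ_{m<N, k∈M m, l∈M m} (f m (S_m∪{k}) + f m (S_m∪{l}) −
f m (S_m) − f m (S_m∪{k,l}))`, `S_m = S ∩ M m` (a junction missing `k` or `l` contributes `0`). -/
theorem period_defect_eq_sum_junction_defects {N : ℕ} {M : ℕ → Finset (Fin 28)} {f : ℕ → Finset (Fin 28) → ℝ}
    {F : Finset (Fin 28) → ℝ} (hF : ∀ A, F A = ∑ m ∈ Finset.range N, f m (A ∩ M m))
    (S : Finset (Fin 28)) (k l : Fin 28) :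
    F (insert k S) + F (insert l S) - F S - F (insert k (insert l S)) =
      ∑ m ∈ (Finset.range N).filter (fun m => k ∈ M m ∧ l ∈ M m),
        (f m (insert k (S ∩ M m)) + f m (insert l (S ∩ M m)) - f m (S ∩ M m) -
          f m (insert k (insert l (S ∩ M m)))) := by
  classical
  rw [hF, hF, hF, hF, ← Finset.sum_add_distrib, ← Finset.sum_sub_distrib, ← Finset.sum_sub_distrib,
    Finset.sum_filter]
  refine Finset.sum_congr rfl fun m _ => ?_
  by_cases hk : k ∈ M m
  · by_cases hl : l ∈ M m
    · rw [if_pos ⟨hk, hl⟩, Finset.insert_inter_of_mem hk, Finset.insert_inter_of_mem hl,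
        Finset.insert_inter_of_mem hk, Finset.insert_inter_of_mem hl]
    · rw [if_neg (fun h => hl h.2), Finset.insert_inter_of_mem hk, Finset.insert_inter_of_notMem hl,
        Finset.insert_inter_of_mem hk, Finset.insert_inter_of_notMem hl]
      ring
  · rw [if_neg (fun h => hk h.1), Finset.insert_inter_of_notMem hk, Finset.insert_inter_of_notMem hk]
    ring

/-! ### Across a wall: the cusp slope is the old chamber functional plus the defect times the splitting -/

/-- **THE KINK OF `σ` ACROSS A COINCIDENCE WALL IS THE LOCAL DEFECT OF THE PERIOD PATTERN FUNCTION.** With the data of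
`cuspSlope_eq_lovasz_period`: let `δ₀, δ₀'` be generic on all 28 forms with flip orders differing by ONE adjacent
transposition of `k ≠ l` (`k` first for `δ₀`: `r_l(δ₀) < r_k(δ₀)`; `l` first for `δ₀'`; no form strictly between them
for `δ₀`; every other form on the same side of the pair for both; the same relative order among the other forms). Then
for every `δ` refined by `δ₀'`:
`cuspSlope a T δ = Σ_j W_j(δ₀)·φ_j(δ)/h_j(a) + m_F·(φ_l(δ)/h_l(a) − φ_k(δ)/h_k(a))` with `W(δ₀)` the global greedy
weights of `δ₀` and `m_F = F(S∪{k}) + F(S∪{l}) − F(S) − F(S∪{k,l})`, `S = {j : r_k(δ₀) < r_j(δ₀)}` — the wall is a kink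
of `σ` iff `m_F ≠ 0`. -/
theorem cuspSlope_eq_greedy_add_defect_period {a : Dir} (hpos : ∀ k, 0 < h28 a k) {T : ℝ} (hT : 0 < T)
    (hper : ∀ k : Fin 28, ∃ z : ℤ, T * h28 a k = z)
    {M : ℕ → Finset (Fin 28)} {f : ℕ → Finset (Fin 28) → ℝ}
    (hf : ∀ m, m + 1 < (bkpts a T).card → ∀ Δ : Fin 8 → ℝ, (∀ k, |phiForm Δ k| < 1) →
      (∀ k, |phiForm Δ k| < wallDist a T) →
        (torusN (bkpt a T m • sParam a + Δ) : ℝ) = f m ((M m).filter fun k => 0 ≤ phiForm Δ k))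
    {F : Finset (Fin 28) → ℝ} (hF : ∀ A, F A = ∑ m ∈ Finset.range ((bkpts a T).card - 1), f m (A ∩ M m))
    {δ₀ δ₀' : Fin 8 → ℝ}
    (hgen : ∀ i j : Fin 28, i ≠ j → phiForm δ₀ i / h28 a i ≠ phiForm δ₀ j / h28 a j)
    (hgen' : ∀ i j : Fin 28, i ≠ j → phiForm δ₀' i / h28 a i ≠ phiForm δ₀' j / h28 a j)
    {k l : Fin 28} (hkl : k ≠ l)
    (hρ : phiForm δ₀ l / h28 a l < phiForm δ₀ k / h28 a k)
    (hρ' : phiForm δ₀' k / h28 a k < phiForm δ₀' l / h28 a l)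
    (hadj : ∀ j : Fin 28, ¬(phiForm δ₀ l / h28 a l < phiForm δ₀ j / h28 a j ∧
      phiForm δ₀ j / h28 a j < phiForm δ₀ k / h28 a k))
    (hside : ∀ j : Fin 28, j ≠ k → j ≠ l →
      (phiForm δ₀ k / h28 a k < phiForm δ₀ j / h28 a j ↔ phiForm δ₀' k / h28 a k < phiForm δ₀' j / h28 a j) ∧
      (phiForm δ₀ l / h28 a l < phiForm δ₀ j / h28 a j ↔ phiForm δ₀' l / h28 a l < phiForm δ₀' j / h28 a j))
    (hsame : ∀ i j : Fin 28, i ≠ k → i ≠ l → j ≠ k → j ≠ l →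
      (phiForm δ₀ i / h28 a i < phiForm δ₀ j / h28 a j ↔ phiForm δ₀' i / h28 a i < phiForm δ₀' j / h28 a j))
    (δ : Fin 8 → ℝ) (href : ∀ i j : Fin 28, phiForm δ i / h28 a i < phiForm δ j / h28 a j →
      phiForm δ₀' i / h28 a i < phiForm δ₀' j / h28 a j) :
    cuspSlope a T δ =
      ∑ j, (F (Finset.univ.filter fun i => phiForm δ₀ j / h28 a j ≤ phiForm δ₀ i / h28 a i) -
          F (Finset.univ.filter fun i => phiForm δ₀ j / h28 a j < phiForm δ₀ i / h28 a i)) * (phiForm δ j / h28 a j) +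
        (F (insert k (Finset.univ.filter fun j => phiForm δ₀ k / h28 a k < phiForm δ₀ j / h28 a j)) +
            F (insert l (Finset.univ.filter fun j => phiForm δ₀ k / h28 a k < phiForm δ₀ j / h28 a j)) -
            F (Finset.univ.filter fun j => phiForm δ₀ k / h28 a k < phiForm δ₀ j / h28 a j) -
            F (insert k (insert l (Finset.univ.filter fun j => phiForm δ₀ k / h28 a k < phiForm δ₀ j / h28 a j)))) *
          (phiForm δ l / h28 a l - phiForm δ k / h28 a k) := by
  rw [cuspSlope_eq_greedy_period_of_refines hpos hT hper hf hF hgen' δ href]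
  have h := greedy_sub_greedy_of_adjacent (M := Finset.univ) F (ρ := fun j => phiForm δ₀ j / h28 a j)
    (ρ' := fun j => phiForm δ₀' j / h28 a j) (fun i _ j _ hij => hgen i j hij) (fun i _ j _ hij => hgen' i j hij)
    (Finset.mem_univ k) (Finset.mem_univ l) hkl hρ hρ' (fun j _ => hadj j) (fun j _ => hside j)
    (fun i _ j _ => hsame i j) (fun j => phiForm δ j / h28 a j)
  linarith

/-- **… so the wall is FLAT for `σ` iff the pooled defect vanishes**: under the hypotheses of
`cuspSlope_eq_greedy_add_defect_period`, if `m_F(S;k,l) = 0` then the chamber functional of `δ₀` still gives `σ` on the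
closed chamber of `δ₀'` (no kink across the wall — P2 g29's 54 flat walls, DATA). -/
theorem cuspSlope_eq_greedy_of_defect_eq_zero_period {a : Dir} (hpos : ∀ k, 0 < h28 a k) {T : ℝ} (hT : 0 < T)
    (hper : ∀ k : Fin 28, ∃ z : ℤ, T * h28 a k = z)
    {M : ℕ → Finset (Fin 28)} {f : ℕ → Finset (Fin 28) → ℝ}
    (hf : ∀ m, m + 1 < (bkpts a T).card → ∀ Δ : Fin 8 → ℝ, (∀ k, |phiForm Δ k| < 1) →
      (∀ k, |phiForm Δ k| < wallDist a T) →
        (torusN (bkpt a T m • sParam a + Δ) : ℝ) = f m ((M m).filter fun k => 0 ≤ phiForm Δ k))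
    {F : Finset (Fin 28) → ℝ} (hF : ∀ A, F A = ∑ m ∈ Finset.range ((bkpts a T).card - 1), f m (A ∩ M m))
    {δ₀ δ₀' : Fin 8 → ℝ}
    (hgen : ∀ i j : Fin 28, i ≠ j → phiForm δ₀ i / h28 a i ≠ phiForm δ₀ j / h28 a j)
    (hgen' : ∀ i j : Fin 28, i ≠ j → phiForm δ₀' i / h28 a i ≠ phiForm δ₀' j / h28 a j)
    {k l : Fin 28} (hkl : k ≠ l)
    (hρ : phiForm δ₀ l / h28 a l < phiForm δ₀ k / h28 a k)
    (hρ' : phiForm δ₀' k / h28 a k < phiForm δ₀' l / h28 a l)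
    (hadj : ∀ j : Fin 28, ¬(phiForm δ₀ l / h28 a l < phiForm δ₀ j / h28 a j ∧
      phiForm δ₀ j / h28 a j < phiForm δ₀ k / h28 a k))
    (hside : ∀ j : Fin 28, j ≠ k → j ≠ l →
      (phiForm δ₀ k / h28 a k < phiForm δ₀ j / h28 a j ↔ phiForm δ₀' k / h28 a k < phiForm δ₀' j / h28 a j) ∧
      (phiForm δ₀ l / h28 a l < phiForm δ₀ j / h28 a j ↔ phiForm δ₀' l / h28 a l < phiForm δ₀' j / h28 a j))
    (hsame : ∀ i j : Fin 28, i ≠ k → i ≠ l → j ≠ k → j ≠ l →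
      (phiForm δ₀ i / h28 a i < phiForm δ₀ j / h28 a j ↔ phiForm δ₀' i / h28 a i < phiForm δ₀' j / h28 a j))
    (hflat : F (insert k (Finset.univ.filter fun j => phiForm δ₀ k / h28 a k < phiForm δ₀ j / h28 a j)) +
        F (insert l (Finset.univ.filter fun j => phiForm δ₀ k / h28 a k < phiForm δ₀ j / h28 a j)) -
        F (Finset.univ.filter fun j => phiForm δ₀ k / h28 a k < phiForm δ₀ j / h28 a j) -
        F (insert k (insert l (Finset.univ.filter fun j => phiForm δ₀ k / h28 a k < phiForm δ₀ j / h28 a j))) = 0)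
    (δ : Fin 8 → ℝ) (href : ∀ i j : Fin 28, phiForm δ i / h28 a i < phiForm δ j / h28 a j →
      phiForm δ₀' i / h28 a i < phiForm δ₀' j / h28 a j) :
    cuspSlope a T δ =
      ∑ j, (F (Finset.univ.filter fun i => phiForm δ₀ j / h28 a j ≤ phiForm δ₀ i / h28 a i) -
          F (Finset.univ.filter fun i => phiForm δ₀ j / h28 a j < phiForm δ₀ i / h28 a i)) *
        (phiForm δ j / h28 a j) := by
  rw [cuspSlope_eq_greedy_add_defect_period hpos hT hper hf hF hgen hgen' hkl hρ hρ' hadj hside hsame δ href, hflat,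
    zero_mul, add_zero]

end Summit.KontsevichZagierPeriods.Zeta5Search.Barrier.ConeGamma

end
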